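import Summits.Parity.GeneralizedHardyLittlewood.Theorems.GreenTaoLevelTwoMNTwoTypeIIHelpers

/-!
# Route `GreenTaoLevelTwo`, crux `MNTwo` (stmt-Parity-21276), line `birth`, stub `stub_mnVertical`:
# the end of Lemma 24: from many small `‖c l₁l₂m₁‖` to a denominator for `c` (GT 2008b §10)

Block V4 / H3 (= AIF §10 Lemma 24 "Type II sum implies major arc", final step) of the
`stub_mnVertical` census (B. Green, T. Tao, *Quadratic uniformity of the Möbius function*, Ann.
Inst. Fourier 58 (2008) = arXiv:math/0606087, §10: "we have `≳ L²` pairs `(l₁,l₂)` for which this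
inequality holds for `≳ M` values of `m₁` … there exists `q ≲ 1` such that
`‖l₁l₂qφ''‖ ≲ 1/M²` … a single `q` … apply Lemma 32 (ii) to `l₂` instead of `m₁` … one last time …
`‖q''q'qφ''(st,st)‖ ≲ 1/L²M²`").  Def-free, explicit: three rounds of
`…MNTwoTypeIIHelpers.dense_pairs_step` starting from the output of
`…MNTwoQuadrilinearCount.many_small_triples`; the auxiliary parameters `δB, δC, δ₁A, δ₁B, δ₁C` are
passed as variables fixed by equations so that the statement stays readable.

* `typeII_denominator` — **the last step of Lemma 24**: `∃ q ≤ Q(κ)`,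
  `‖q c‖_{ℝ/ℤ} ≤ C(κ)/(N n₃ n₂ n₁)`.

References: [GreenTao2008QuadraticMobius] arXiv:math/0606087 §10 (proof of Lemma 24), App. A
Lemma 32 (ii).
-/

noncomputable section

open Finset

namespace Summit.Parity.GeneralizedHardyLittlewood.GreenTaoLevelTwoMNTwoTypeIIDenominator

open Literature.NumberTheory.Sieve.Vinogradov (distInt)
open Summit.Parity.GeneralizedHardyLittlewood.GreenTaoLevelTwoMNTwoTypeIIHelpers (dense_pairs_step)

/-- **Lemma 24, last step (three rounds of Lemma 32 (ii)).**  Let `Sᵢ = [aᵢ,bᵢ] ⊂ ℤ`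
(`i = 1,2,3`, sizes `nᵢ = bᵢ − aᵢ + 1`), `c ∈ ℝ`, `0 < κ ≤ 1`, `N > 0`, shifts `l₁', l₂', m₁'`, and
suppose at least `(κ/2) n₁n₂n₃` triples `(l₁,l₂,m₁) ∈ S₁×S₂×S₃` have
`‖c(l₁−l₁')(l₂−l₂')(m₁−m₁')‖_{ℝ/ℤ} ≤ 1/(κN)` (the output of `many_small_triples`).  With the
explicit parameters `δ₁A = 1/(κN)`, `δB = (κ/2)³/51344`, `δ₁B = 2630455808·64·δ₁A/((κ/2)⁶n₃)`,
`δC = δB³/51344`, `δ₁C = 2630455808·64·δ₁B/(δB⁶n₂)`, under the largeness conditions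
`δ₁A ≤ κ/16`, `2 < (κ/4)²n₃`, `δ₁B ≤ δB/8`, `2 < (δB/2)²n₂`, `δ₁C ≤ δC/8`, `2 < (δC/2)²n₁`, there is
`1 ≤ q ≤ (25672/(κ/2)²)(25672/δB²)(25672/δC²)` with
`‖q c‖_{ℝ/ℤ} ≤ 2630455808·64·δ₁C/(δC⁶ n₁)`.
[cite: GreenTao2008QuadraticMobius, §10 (proof of Lemma 24, final step)] -/
theorem typeII_denominator (c : ℝ) {a₁ b₁ a₂ b₂ a₃ b₃ : ℤ} (h₁ : a₁ ≤ b₁) (h₂ : a₂ ≤ b₂)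
    (h₃ : a₃ ≤ b₃) (l₁' l₂' m₁' : ℤ) {κ N δ₁A δB δ₁B δC δ₁C : ℝ} (hκ : 0 < κ) (hκ1 : κ ≤ 1)
    (hN : 0 < N) (hδ₁A : δ₁A = 1 / (κ * N)) (hδB : δB = (κ / 2) ^ 3 / 51344)
    (hδ₁B : δ₁B = 2630455808 * 64 * δ₁A / ((κ / 2) ^ 6 * ((b₃ - a₃ + 1 : ℤ) : ℝ)))
    (hδC : δC = δB ^ 3 / 51344)
    (hδ₁C : δ₁C = 2630455808 * 64 * δ₁B / (δB ^ 6 * ((b₂ - a₂ + 1 : ℤ) : ℝ)))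
    (H1 : δ₁A ≤ κ / 16) (H2 : 2 < (κ / 4) ^ 2 * ((b₃ - a₃ + 1 : ℤ) : ℝ))
    (H3 : δ₁B ≤ δB / 8) (H4 : 2 < (δB / 2) ^ 2 * ((b₂ - a₂ + 1 : ℤ) : ℝ))
    (H5 : δ₁C ≤ δC / 8) (H6 : 2 < (δC / 2) ^ 2 * ((b₁ - a₁ + 1 : ℤ) : ℝ))
    (hgood : κ / 2 * ((b₁ - a₁ + 1 : ℤ) : ℝ) * ((b₂ - a₂ + 1 : ℤ) : ℝ) * ((b₃ - a₃ + 1 : ℤ) : ℝ) ≤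
      #(((Icc a₁ b₁ ×ˢ Icc a₂ b₂) ×ˢ Icc a₃ b₃).filter fun p =>
        distInt (c * (p.1.1 - l₁') * (p.1.2 - l₂') * (p.2 - m₁')) ≤ 1 / (κ * N))) :
    ∃ q : ℕ, 1 ≤ q ∧
      (q : ℝ) ≤ (25672 / (κ / 2) ^ 2) * (25672 / δB ^ 2) * (25672 / δC ^ 2) ∧
      distInt (q * c) ≤ 2630455808 * 64 * δ₁C / (δC ^ 6 * ((b₁ - a₁ + 1 : ℤ) : ℝ)) := by
  classical
  -- sizes of the intervals
  have hn : ∀ {a b : ℤ}, a ≤ b → (#(Icc a b) : ℝ) = ((b - a + 1 : ℤ) : ℝ) := by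
    intro a b hab
    rw [Int.card_Icc]
    have : (((b + 1 - a).toNat : ℕ) : ℤ) = b - a + 1 := by
      rw [Int.toNat_of_nonneg (by omega)]; ring
    exact_mod_cast this
  have hn₁ := hn h₁
  have hn₂ := hn h₂
  have hn₃ := hn h₃
  have hn₂pos : (0 : ℝ) < ((b₂ - a₂ + 1 : ℤ) : ℝ) := by
    have : (0 : ℤ) < b₂ - a₂ + 1 := by omega
    exact_mod_cast this
  have hn₃pos : (0 : ℝ) < ((b₃ - a₃ + 1 : ℤ) : ℝ) := by
    have : (0 : ℤ) < b₃ - a₃ + 1 := by omega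
    exact_mod_cast this
  have hδ₁A0 : 0 ≤ δ₁A := by rw [hδ₁A]; positivity
  have hδB0 : 0 < δB := by rw [hδB]; positivity
  have hδB1 : δB ≤ 1 := by
    rw [hδB, div_le_one (by norm_num)]
    have : (κ / 2) ^ 3 ≤ 1 := pow_le_one₀ (by positivity) (by linarith)
    linarith
  have hδ₁B0 : 0 ≤ δ₁B := by rw [hδ₁B]; positivity
  have hδC0 : 0 < δC := by rw [hδC]; positivity
  have hδC1 : δC ≤ 1 := by
    rw [hδC, div_le_one (by norm_num)]
    have : δB ^ 3 ≤ 1 := pow_le_one₀ hδB0.le hδB1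
    linarith
  have hδ₁C0 : 0 ≤ δ₁C := by rw [hδ₁C]; positivity
  ------------------------------------------------------------------
  -- Round 1: parameters `(l₁,l₂) ∈ S₁ × S₂`, interval `S₃`, `α(l₁,l₂) = c(l₁−l₁')(l₂−l₂')`
  ------------------------------------------------------------------
  have hR1 := dense_pairs_step (Icc a₁ b₁ ×ˢ Icc a₂ b₂) h₃
    (fun p : ℤ × ℤ => c * (p.1 - l₁') * (p.2 - l₂')) m₁' (δ := κ / 2) (δ₁ := δ₁A)
    (by positivity) (by linarith) hδ₁A0 (by linarith)
    (by rw [show κ / 2 / 2 = κ / 4 by ring]; exact H2)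
    (by
      rw [Finset.card_product, Nat.cast_mul, hn₁, hn₂]
      refine (le_of_eq (by ring)).trans (hgood.trans (le_of_eq ?_))
      rw [hδ₁A]
      congr 2
      refine Finset.filter_congr fun p _ => ?_
      have e : c * (p.1.1 - l₁') * (p.1.2 - l₂') * (p.2 - m₁') =
          c * (p.1.1 - l₁') * (p.1.2 - l₂') * ((p.2 - m₁' : ℤ) : ℝ) := by push_cast; ring
      rw [e])
  obtain ⟨q₁, hq₁1, hq₁Q, hG₁⟩ := hR1
  -- rewrite the round-1 output in the round-2 input shape
  have hδ₁B' : 2630455808 * 64 * δ₁A / ((κ / 2) ^ 6 * ((b₃ - a₃ + 1 : ℤ) : ℝ)) = δ₁B := hδ₁B.symm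
  rw [hδ₁B'] at hG₁
  have hG₁' : δB * #(Icc a₁ b₁) * ((b₂ - a₂ + 1 : ℤ) : ℝ) ≤
      #((Icc a₁ b₁ ×ˢ Icc a₂ b₂).filter fun p : ℤ × ℤ =>
        distInt ((q₁ * c * (p.1 - l₁')) * ((p.2 - l₂' : ℤ) : ℝ)) ≤ δ₁B) := by
    have e1 : δB * #(Icc a₁ b₁) * ((b₂ - a₂ + 1 : ℤ) : ℝ) =
        (κ / 2) ^ 3 / 51344 * #(Icc a₁ b₁ ×ˢ Icc a₂ b₂) := by
      rw [Finset.card_product, Nat.cast_mul, hn₂, hδB]; ring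
    rw [e1]
    refine hG₁.trans (le_of_eq ?_)
    congr 2
    refine Finset.filter_congr fun p _ => ?_
    have e : (q₁ : ℝ) * (c * (p.1 - l₁') * (p.2 - l₂')) =
        q₁ * c * (p.1 - l₁') * ((p.2 - l₂' : ℤ) : ℝ) := by push_cast; ring
    rw [e]
  ------------------------------------------------------------------
  -- Round 2: parameters `l₁ ∈ S₁`, interval `S₂`, `α(l₁) = q₁ c (l₁ − l₁')`
  ------------------------------------------------------------------
  have hR2 := dense_pairs_step (Icc a₁ b₁) h₂ (fun l₁ : ℤ => q₁ * c * (l₁ - l₁')) l₂'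
    (δ := δB) (δ₁ := δ₁B) hδB0 hδB1 hδ₁B0 H3 H4 hG₁'
  obtain ⟨q₂, hq₂1, hq₂Q, hG₂⟩ := hR2
  have hδ₁C' : 2630455808 * 64 * δ₁B / (δB ^ 6 * ((b₂ - a₂ + 1 : ℤ) : ℝ)) = δ₁C := hδ₁C.symm
  rw [hδ₁C'] at hG₂
  have hG₂' : δC * #(Finset.univ : Finset Unit) * ((b₁ - a₁ + 1 : ℤ) : ℝ) ≤
      #(((Finset.univ : Finset Unit) ×ˢ Icc a₁ b₁).filter fun p : Unit × ℤ =>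
        distInt ((q₂ * q₁ * c) * ((p.2 - l₁' : ℤ) : ℝ)) ≤ δ₁C) := by
    rw [Finset.card_univ, Fintype.card_unit, Nat.cast_one, mul_one, ← hn₁]
    have e1 : δC * #(Icc a₁ b₁) = δB ^ 3 / 51344 * #(Icc a₁ b₁) := by rw [hδC]
    rw [e1]
    refine hG₂.trans (le_of_eq ?_)
    -- `{()} × G₂` has the same cardinality as `G₂`
    have hmap : ((Finset.univ : Finset Unit) ×ˢ Icc a₁ b₁).filter (fun p : Unit × ℤ =>
        distInt ((q₂ * q₁ * c) * ((p.2 - l₁' : ℤ) : ℝ)) ≤ δ₁C) =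
        ((Icc a₁ b₁).filter fun l₁ : ℤ =>
          distInt ((q₂ * q₁ * c) * ((l₁ - l₁' : ℤ) : ℝ)) ≤ δ₁C).map
          ⟨fun l₁ : ℤ => ((), l₁), fun x y hxy => (Prod.mk.inj hxy).2⟩ := by
      ext ⟨u, l₁⟩
      cases u
      simp only [Finset.mem_filter, Finset.mem_product, Finset.mem_univ, true_and,
        Finset.mem_map, Function.Embedding.coeFn_mk, Prod.mk.injEq]
      constructor
      · rintro ⟨h1, h2⟩; exact ⟨l₁, ⟨h1, h2⟩, rfl⟩
      · rintro ⟨l, ⟨h1, h2⟩, -, rfl⟩; exact ⟨h1, h2⟩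
    rw [hmap, Finset.card_map]
    congr 2
    refine Finset.filter_congr fun l₁ _ => ?_
    have e : (q₂ : ℝ) * (q₁ * c * (l₁ - l₁')) = q₂ * q₁ * c * ((l₁ - l₁' : ℤ) : ℝ) := by
      push_cast; ring
    rw [e]
  ------------------------------------------------------------------
  -- Round 3: a single parameter, interval `S₁`, `α = q₂ q₁ c`
  ------------------------------------------------------------------
  have hR3 := dense_pairs_step (Finset.univ : Finset Unit) h₁ (fun _ : Unit => q₂ * q₁ * c) l₁'
    (δ := δC) (δ₁ := δ₁C) hδC0 hδC1 hδ₁C0 H5 H6 hG₂'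
  obtain ⟨q₃, hq₃1, hq₃Q, hG₃⟩ := hR3
  -- the good set of round 3 is nonempty, hence contains `()`
  have hne : ((Finset.univ : Finset Unit).filter fun u : Unit =>
      distInt (q₃ * (q₂ * q₁ * c)) ≤
        2630455808 * 64 * δ₁C / (δC ^ 6 * ((b₁ - a₁ + 1 : ℤ) : ℝ))).Nonempty := by
    rw [← Finset.card_pos]
    have hpos : 0 < δC ^ 3 / 51344 * (#(Finset.univ : Finset Unit) : ℝ) := by
      rw [Finset.card_univ, Fintype.card_unit, Nat.cast_one, mul_one]; positivity
    exact_mod_cast hpos.trans_le hG₃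
  obtain ⟨u, hu⟩ := hne
  rw [Finset.mem_filter] at hu
  refine ⟨q₃ * q₂ * q₁, ?_, ?_, ?_⟩
  · exact Nat.mul_pos (Nat.mul_pos hq₃1 hq₂1) hq₁1
  · push_cast
    have hA : (0 : ℝ) ≤ 25672 / (κ / 2) ^ 2 := by positivity
    have hB : (0 : ℝ) ≤ 25672 / δB ^ 2 := by positivity
    calc (q₃ : ℝ) * q₂ * q₁ ≤ (25672 / δC ^ 2) * (25672 / δB ^ 2) * (25672 / (κ / 2) ^ 2) :=
          mul_le_mul (mul_le_mul hq₃Q hq₂Q (Nat.cast_nonneg _) (by positivity)) hq₁Q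
            (Nat.cast_nonneg _) (by positivity)
      _ = _ := by ring
  · have e : ((q₃ * q₂ * q₁ : ℕ) : ℝ) * c = q₃ * (q₂ * q₁ * c) := by push_cast; ring
    rw [e]
    exact hu.2

end Summit.Parity.GeneralizedHardyLittlewood.GreenTaoLevelTwoMNTwoTypeIIDenominator
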